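import Mathlib
import HarnessLib
import Summits.CriticalPhenomena.CardyFormulaZ2.Theorems.CardyMagicRigidityMagicFormulaTLatticeReflection
import Summits.CriticalPhenomena.CardyFormulaZ2.Theorems.CardyMagicRigidityMagicFormulaTLoopReflection
import Summits.CriticalPhenomena.CardyFormulaZ2.Theorems.CardyMagicRigidityMagicFormulaTStubDilation
import Summits.CriticalPhenomena.CardyFormulaZ2.Theorems.CardyMagicRigidityMagicFormulaTSmearedCentring
import Summits.CriticalPhenomena.CardyFormulaZ2.Theorems.CardyMagicRigidityTransferContinuityReduction
import Literature.Probability.RandomPlanarGeometry.NestingTransform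

/-!
# The odd sector of the order-3 coefficient vanishes exactly (crux `MagicFormulaT`, line `Sketch`)

Crux `Summit.CriticalPhenomena.CardyFormulaZ2.Theses.CardyMagicRigidity.MagicFormulaT`
(stmt-CriticalPhenomena-4836), line `Sketch`, registered sub-goal `threePoint_oddSector` cut out
of the open order-3 stub `stub_threePoint` (`E_{1/2}[3A₁³ − 12A₁A₂ + 8A₃] → 0`,
`A_m = Σ_{u interface loop of δ𝕋} θ_u(f)^m`, `θ_u(f) = u.nestingPhase f = ∫_{W(u,·) ≠ 0} f`).

**Theorem (`threePoint_oddSector`).** If the density `f : ℂ → ℝ` is odd under the point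
reflection through the origin, `f(−z) = −f(z)`, then for EVERY mesh `δ > 0`
`E_{1/2}[3A₁³ − 12A₁A₂ + 8A₃] = 0` exactly (no measurability, boundedness, support or
neutrality hypothesis is needed: junk values of the set integrals and of the `finsum`s agree on
both sides of every identity used).

Proof.
1. Mesh `δ` → mesh `1` (`tos_finsum_loops_eq_dilate`): the loops of `δ𝕋` are the dilates of the
   loops of `𝕋` (`loopSet_eq_image`, an injective re-indexing `imageOn_mul_injective`), interiors
   dilate (`setOf_wind_imageOn_mul_ne_zero`) and `∫_{δA} f = ∫_A δ² f(δ·)`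
   (`setIntegral_smul_set_eq`), so `Σ_u φ(θ_u(f))` at mesh `δ` is `Σ_u φ(θ_u(f_δ))` at mesh `1`
   with the dilated density `f_δ(z) = δ² f(δz)`, which is odd again (`tos_dilate_odd`).
2. Reflection at mesh `1` through the origin (`triEmbed 0 = 0`): the loops of the reflected
   configuration `−ω` are the reflected loops (`loops_siteLoopConfig_reflect`, injective
   re-indexing `imageOn_reflect_injective`), winding numbers are reflection invariant
   (`wind_imageOn_reflect`), so `{W(−u,·) ≠ 0} = −{W(u,·) ≠ 0}` and, Lebesgue measure on `ℂ` being
   invariant under `z ↦ p − z` (`Measure.measurePreserving_sub_left`), `θ_{−u}(g) = θ_u(g(−·)) =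
   −θ_u(g)` for odd `g` (`tos_nestingPhase_reflect_zero_of_odd`). Hence under `ω ↦ −ω`:
   `A₁ ↦ −A₁`, `A₂ ↦ A₂`, `A₃ ↦ −A₃`, and the integrand `P₃ = 3A₁³ − 12A₁A₂ + 8A₃` is odd.
3. `ω ↦ −ω` preserves `P_{1/2}` (`integral_comp_reflect`), so `∫ P₃ = ∫ P₃ ∘ (−) = −∫ P₃`, whence
   `∫ P₃ = 0` (`integral_neg` is unconditional; `tos_integral_eq_zero_of_reflect_odd`).

Everything is proved from landed tree theorems and Mathlib; no named fact is used; no definition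
is introduced.
-/

noncomputable section

namespace Summit.CriticalPhenomena.CardyFormulaZ2.Cruxes.MagicFormulaT.LineSketch

open MeasureTheory Filter Set
open scoped Real Topology BigOperators ENNReal
open Literature.Probability.RandomPlanarGeometry Literature.Probability.Percolation
  Literature.Probability.LatticeModels

/-! ## Mesh `δ` → mesh `1`: sums over the loops dilate -/

/-- **Sums over the loops dilate**: for every `φ : ℝ → ℝ`,
`Σ_{u loop of δ𝕋} φ(θ_u(f)) = Σ_{u loop of 𝕋} φ(θ_u(f_δ))`, `f_δ(z) = δ² f(δ z)` (the loops of
`δ𝕋` are the dilates of the loops of `𝕋`, interiors dilate, `∫_{δA} f = ∫_A δ² f(δ·)`; the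
`φ`-version of `finsum_nestingPhase_eq_finsum_dilate`, junk values included). -/
theorem tos_finsum_loops_eq_dilate (φ : ℝ → ℝ) (f : ℂ → ℝ) {δ : ℝ} (hδ : 0 < δ)
    (ω : SiteConfig (Site 2)) :
    (∑ᶠ u ∈ (siteLoopConfig δ ω).loops, φ (u.nestingPhase f)) =
      ∑ᶠ u ∈ (siteLoopConfig 1 ω).loops,
        φ (u.nestingPhase fun z ↦ δ ^ 2 * f ((δ : ℂ) * z)) := by
  rw [Summit.CriticalPhenomena.CardyFormulaZ2.Theorems.loops_siteLoopConfig,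
    Summit.CriticalPhenomena.CardyFormulaZ2.Theorems.loops_siteLoopConfig, loopSet_eq_image δ ω,
    finsum_mem_image (imageOn_mul_injective hδ.ne').injOn]
  refine finsum_mem_congr rfl fun u _ ↦ ?_
  rw [UnbasedLoop.nestingPhase, UnbasedLoop.nestingPhase, setOf_wind_imageOn_mul_ne_zero hδ u,
    setIntegral_smul_set_eq f hδ]

/-- **The dilate `f_δ(z) = δ² f(δ z)` of an odd density is odd.** -/
theorem tos_dilate_odd {f : ℂ → ℝ} (hf : ∀ z, f (-z) = -f z) (δ : ℝ) (z : ℂ) :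
    δ ^ 2 * f ((δ : ℂ) * -z) = -(δ ^ 2 * f ((δ : ℂ) * z)) := by
  rw [mul_neg, hf, mul_neg]

/-! ## Reflection at mesh `1`: the phase of the reflected loop -/

/-- **Interiors reflect**: `{W(p − u, ·) ≠ 0} = (p − ·) ⁻¹' {W(u, ·) ≠ 0}` (winding numbers are
reflection invariant, junk values included: `wind_imageOn_reflect`). -/
theorem tos_setOf_wind_imageOn_reflect_ne_zero (p : ℂ) (u : UnbasedLoop ℂ) :
    {z : ℂ | (UnbasedLoop.imageOn (fun z ↦ p - z) univ u).wind z ≠ 0} =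
      (fun z ↦ p - z) ⁻¹' {z : ℂ | u.wind z ≠ 0} := by
  ext z
  simp only [mem_preimage, mem_setOf_eq]
  rw [← wind_imageOn_reflect p u (p - z), sub_sub_cancel]

/-- **The phase of the reflected loop is the phase of the reflected density**:
`θ_{p − u}(g) = θ_u(g(p − ·))` for EVERY `g : ℂ → ℝ` (Lebesgue measure on `ℂ` is invariant under
the point reflection `z ↦ p − z`, a measurable equivalence; no integrability is needed, both
sides are junk together). -/
theorem tos_nestingPhase_imageOn_reflect (p : ℂ) (g : ℂ → ℝ) (u : UnbasedLoop ℂ) :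
    (UnbasedLoop.imageOn (fun z ↦ p - z) univ u).nestingPhase g =
      u.nestingPhase fun z ↦ g (p - z) := by
  rw [UnbasedLoop.nestingPhase, UnbasedLoop.nestingPhase, tos_setOf_wind_imageOn_reflect_ne_zero]
  have h := (Measure.measurePreserving_sub_left volume p).setIntegral_preimage_emb
    (MeasurableEquiv.subLeft p).measurableEmbedding (fun z ↦ g (p - z)) {z : ℂ | u.wind z ≠ 0}
  simp only [sub_sub_cancel] at h
  exact h

/-- **The phase is odd in the density**: `θ_u(−g) = −θ_u(g)` (`integral_neg`, unconditional). -/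
theorem tos_nestingPhase_neg (g : ℂ → ℝ) (u : UnbasedLoop ℂ) :
    (u.nestingPhase fun z ↦ -g z) = -u.nestingPhase g := by
  rw [UnbasedLoop.nestingPhase, UnbasedLoop.nestingPhase, integral_neg]

/-- **For an odd density, the phase of the loop reflected through the origin is minus the
phase**: `θ_{−u}(g) = −θ_u(g)` (the reflection centre is `triEmbed 0 = 0`). -/
theorem tos_nestingPhase_reflect_zero_of_odd {g : ℂ → ℝ} (hg : ∀ z, g (-z) = -g z)
    (u : UnbasedLoop ℂ) :
    (UnbasedLoop.imageOn (fun z ↦ triEmbed (0 : Site 2) - z) univ u).nestingPhase g =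
      -u.nestingPhase g := by
  rw [tos_nestingPhase_imageOn_reflect, ← tos_nestingPhase_neg]
  congr 1
  funext z
  rw [triEmbed_zero, zero_sub, hg]

/-- **Sums over the loops of the reflected configuration** (mesh `1`, reflection through the
origin, odd density `g`): `Σ_{u loop of −ω} φ(θ_u(g)) = Σ_{u loop of ω} φ(−θ_u(g))` for every
`φ : ℝ → ℝ` (the loops of `−ω` are the reflected loops, `loops_siteLoopConfig_reflect`, an
injective re-indexing, `imageOn_reflect_injective`; junk values included). -/
theorem tos_finsum_loops_reflect (φ : ℝ → ℝ) {g : ℂ → ℝ} (hg : ∀ z, g (-z) = -g z)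
    (ω : SiteConfig (Site 2)) :
    (∑ᶠ u ∈ (siteLoopConfig 1 ((Equiv.subLeft (0 : Site 2)) '' ω)).loops,
        φ (u.nestingPhase g)) =
      ∑ᶠ u ∈ (siteLoopConfig 1 ω).loops, φ (-u.nestingPhase g) := by
  rw [loops_siteLoopConfig_reflect, finsum_mem_image (imageOn_reflect_injective _).injOn]
  exact finsum_mem_congr rfl fun u _ ↦ by rw [tos_nestingPhase_reflect_zero_of_odd hg]

/-- `Σ_{u ∈ s} −θ_u = −Σ_{u ∈ s} θ_u` for the `finsum` over a set of loops, junk values included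
(no finiteness needed). -/
theorem tos_finsum_mem_neg (s : Set (UnbasedLoop ℂ)) (θ : UnbasedLoop ℂ → ℝ) :
    ∑ᶠ u ∈ s, -θ u = -∑ᶠ u ∈ s, θ u := by
  simp only [finsum_neg_distrib]

/-! ## Odd observables have zero mean -/

/-- **An observable odd under a lattice point reflection has zero mean** under `P_p`: if
`F((c − ·) '' ω) = −F(ω)` for all `ω` then `∫ F dP_p = 0` (`integral_comp_reflect`:
`∫ F((c − ·) '' ω) = ∫ F`, and `∫ −F = −∫ F` unconditionally). -/
theorem tos_integral_eq_zero_of_reflect_odd (c : Site 2) (p : unitInterval)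
    (F : SiteConfig (Site 2) → ℝ) (hF : ∀ ω, F ((Equiv.subLeft c) '' ω) = -F ω) :
    ∫ ω, F ω ∂(triSitePercolation p) = 0 := by
  have h := integral_comp_reflect c p F
  simp_rw [hF, integral_neg] at h
  linarith

/-! ## The odd sector, at mesh `1` and at every mesh -/

/-- **The odd sector at mesh `1`**: for an odd density `g`, `E_{1/2}[3A₁³ − 12A₁A₂ + 8A₃] = 0`
exactly, `A_m = Σ_{u loop of 𝕋} θ_u(g)^m` (under `ω ↦ −ω`: `A₁ ↦ −A₁`, `A₂ ↦ A₂`, `A₃ ↦ −A₃`,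
so the integrand is odd under a measure-preserving involution). -/
theorem tos_threePoint_oddSector_one {g : ℂ → ℝ} (hg : ∀ z, g (-z) = -g z) :
    ∫ ω, (3 * (∑ᶠ u ∈ (siteLoopConfig 1 ω).loops, u.nestingPhase g) ^ 3 -
      12 * (∑ᶠ u ∈ (siteLoopConfig 1 ω).loops, u.nestingPhase g) *
        (∑ᶠ u ∈ (siteLoopConfig 1 ω).loops, u.nestingPhase g ^ 2) +
      8 * (∑ᶠ u ∈ (siteLoopConfig 1 ω).loops, u.nestingPhase g ^ 3)) ∂(triSitePercolation half) =
      0 := by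
  have h1 : ∀ ω : SiteConfig (Site 2),
      (∑ᶠ u ∈ (siteLoopConfig 1 ((Equiv.subLeft (0 : Site 2)) '' ω)).loops, u.nestingPhase g) =
        -∑ᶠ u ∈ (siteLoopConfig 1 ω).loops, u.nestingPhase g :=
    fun ω ↦ (tos_finsum_loops_reflect (fun x ↦ x) hg ω).trans (tos_finsum_mem_neg _ _)
  have h2 : ∀ ω : SiteConfig (Site 2),
      (∑ᶠ u ∈ (siteLoopConfig 1 ((Equiv.subLeft (0 : Site 2)) '' ω)).loops,
          u.nestingPhase g ^ 2) =
        ∑ᶠ u ∈ (siteLoopConfig 1 ω).loops, u.nestingPhase g ^ 2 :=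
    fun ω ↦ (tos_finsum_loops_reflect (fun x ↦ x ^ 2) hg ω).trans
      (finsum_mem_congr rfl fun u _ ↦ neg_sq _)
  have h3 : ∀ ω : SiteConfig (Site 2),
      (∑ᶠ u ∈ (siteLoopConfig 1 ((Equiv.subLeft (0 : Site 2)) '' ω)).loops,
          u.nestingPhase g ^ 3) =
        -∑ᶠ u ∈ (siteLoopConfig 1 ω).loops, u.nestingPhase g ^ 3 :=
    fun ω ↦ ((tos_finsum_loops_reflect (fun x ↦ x ^ 3) hg ω).trans
      (finsum_mem_congr rfl fun u _ ↦ Odd.neg_pow (by decide) _)).trans (tos_finsum_mem_neg _ _)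
  refine tos_integral_eq_zero_of_reflect_odd 0 half _ fun ω ↦ ?_
  rw [h1, h2, h3]
  ring

/-- **Sub-goal `threePoint_oddSector` of line `Sketch` (crux `MagicFormulaT`) — THE ODD SECTOR OF
ORDER 3 VANISHES EXACTLY AT EVERY MESH.** If `f : ℂ → ℝ` is odd under the point reflection through
the origin, `f(−z) = −f(z)`, then for every `δ > 0`
`E_{1/2}[3A₁³ − 12A₁A₂ + 8A₃] = 0`, `A_m = Σ_{u interface loop of δ𝕋} θ_u(f)^m`,
`θ_u(f) = ∫_{W(u,·) ≠ 0} f`: pass to mesh `1` with the odd dilated density `δ² f(δ·)`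
(`tos_finsum_loops_eq_dilate`), where `ω ↦ −ω` preserves `P_{1/2}`, maps loops to reflected
loops, preserves winding numbers and negates the phases, so the integrand is odd under a
measure-preserving involution (`tos_threePoint_oddSector_one`). -/
theorem threePoint_oddSector : ∀ (f : ℂ → ℝ), (∀ z, f (-z) = -f z) → ∀ δ : ℝ, 0 < δ →
    ∫ ω, (3 * (∑ᶠ u ∈ (siteLoopConfig δ ω).loops, u.nestingPhase f) ^ 3 -
      12 * (∑ᶠ u ∈ (siteLoopConfig δ ω).loops, u.nestingPhase f) *
        (∑ᶠ u ∈ (siteLoopConfig δ ω).loops, u.nestingPhase f ^ 2) +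
      8 * (∑ᶠ u ∈ (siteLoopConfig δ ω).loops, u.nestingPhase f ^ 3)) ∂(triSitePercolation half) =
      0 := by
  intro f hf δ hδ
  have h1 : ∀ ω : SiteConfig (Site 2), (∑ᶠ u ∈ (siteLoopConfig δ ω).loops, u.nestingPhase f) =
      ∑ᶠ u ∈ (siteLoopConfig 1 ω).loops, u.nestingPhase fun z ↦ δ ^ 2 * f ((δ : ℂ) * z) :=
    fun ω ↦ tos_finsum_loops_eq_dilate (fun x ↦ x) f hδ ω
  have h2 : ∀ ω : SiteConfig (Site 2),
      (∑ᶠ u ∈ (siteLoopConfig δ ω).loops, u.nestingPhase f ^ 2) =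
        ∑ᶠ u ∈ (siteLoopConfig 1 ω).loops,
          (u.nestingPhase fun z ↦ δ ^ 2 * f ((δ : ℂ) * z)) ^ 2 :=
    fun ω ↦ tos_finsum_loops_eq_dilate (fun x ↦ x ^ 2) f hδ ω
  have h3 : ∀ ω : SiteConfig (Site 2),
      (∑ᶠ u ∈ (siteLoopConfig δ ω).loops, u.nestingPhase f ^ 3) =
        ∑ᶠ u ∈ (siteLoopConfig 1 ω).loops,
          (u.nestingPhase fun z ↦ δ ^ 2 * f ((δ : ℂ) * z)) ^ 3 :=
    fun ω ↦ tos_finsum_loops_eq_dilate (fun x ↦ x ^ 3) f hδ ω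
  simp_rw [h1, h2, h3]
  exact tos_threePoint_oddSector_one fun z ↦ tos_dilate_odd hf δ z

end Summit.CriticalPhenomena.CardyFormulaZ2.Cruxes.MagicFormulaT.LineSketch

end
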